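import Mathlib
import HarnessLib
import Summits.AtomisticToContinuum.FouriersLaw.Theses.JunctionLocality
import Summits.AtomisticToContinuum.FouriersLaw.Theorems.JunctionLocalitySuperadditiveResistanceStubInsertionIdentity
import Summits.AtomisticToContinuum.FouriersLaw.Theorems.JunctionLocalitySuperadditiveResistanceDeviceBlockRestriction
import Summits.AtomisticToContinuum.FouriersLaw.Theorems.JunctionLocalitySuperadditiveResistanceStubBypassBoundAux3
import Summits.AtomisticToContinuum.FouriersLaw.Theorems.JunctionLocalitySuperadditiveResistanceTerminationJunctionLift

/-!
# Helper `helper_roughnessFloor` of line `thermalise-then-cut-probe-insertion` (crux stmt-AtomisticToContinuum-11748) — part I: the junction pairing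

Support file for the registered helper `helper_roughnessFloor` (part II,
`…SuperadditiveResistanceRoughnessFloor.lean`): the tightness, in order, of the lead's stub
`stub_junctionRoughnessLTE`, `G² ≤ (∫ ĵ² dμ_T) · v_K(h − θe_K)` with the junction flux
`ĵ = p_{N−1} V'(q_N − q_{N−1})`, `V'(r) = r + βr³`. This part proves, at fixed `N, M ≥ 2`:

* `floor_generator_leftEnergy`: the plain generator of the LEFT-BLOCK ENERGY `H_N ∘ π_N` is
  `γ(T − p_0²) + ĵ` (block restriction `generator_comp_restrictLeft`: only the junction bond of
  `H_{N+M}` is missing from `H_N`, only bath `0` acts on the left block);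
* `floor_memLp_jhat`: `ĵ ∈ L²(μ_T)` (the junction Boltzmann factor tames `V'`,
  `memLp_junctionForce_mul_comp_restrictLeft`);
* `floor_junction_pairing`: for `h ∈ L²(μ_T)` solving the plain chain's weak first-order equation,
  `∫ ĵ h dμ_T = γ ∫ (p_0² − T) h dμ_T − γ/2` — the weak equation tested against `H_N ∘ π_N`
  (`pinnedChain_weak_pairing`), with `∫ (H_N∘π_N) W dμ_T = γ/2` by Gaussian integration by parts in
  `p_0` (`integral_mul_sq_sub_gibbsMeasure`, equipartition) and invisibility of the left block to
  the far bath momentum (`integral_comp_restrictLeft_mul_sq_sub`). With the Kubo link of the plain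
  frame this is `∫ ĵ h dμ_T = −G`.

All folklore; no definitions; nothing is taken as a named fact.
-/

noncomputable section

open MeasureTheory Filter Topology ProbabilityTheory
open scoped ContDiff NNReal ENNReal
open Literature.MathematicalPhysics.KineticTheory.HeatConduction

namespace Summit.AtomisticToContinuum.FouriersLaw.Cruxes.SuperadditiveResistance.ThermaliseThenCutProbeInsertion

open InsertionToolbox InsertionToolbox.Assembly
open Summit.AtomisticToContinuum.FouriersLaw.Theorems.SuperadditiveResistance.TerminationLocality
  (memLp_comp_restrictLeft)
open FloatingProbeBypassLaplacian (integral_mul_sq_sub_gibbsMeasure integral_comp_restrictLeft_mul_sq_sub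
  pinnedChain_integral_snd_sq pinnedChain_memLp_two_snd pinnedChain_memLp_two_snd_sq contDiff_restrictLeft)

section Floor

variable {ω₂ lam β : ℝ} {N M : ℕ}

/-- **The plain generator of the left-block energy.** For `N ≥ 2`, `M ≥ 1`:
`L_T (H_N ∘ π_N) = γ(T − p_0²) + p_{N−1} V'(q_N − q_{N−1})` (Liouville part: only the junction bond
of `H_{N+M}` is missing from `H_N`; bath part: only site `0` acts on the left block). -/
theorem floor_generator_leftEnergy (ω₂ lam β γ T : ℝ) (hN : 2 ≤ N) (hM : 1 ≤ M)
    (x : PhaseSpace (N + M)) :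
    (pinnedChain ω₂ lam β γ).generator (N + M) T T
        ((pinnedChain ω₂ lam β γ).hamiltonian N ∘
          fun y : PhaseSpace (N + M) => (y.1 ∘ Fin.castAdd M, y.2 ∘ Fin.castAdd M)) x =
      γ * (T - x.2 ⟨0, by omega⟩ ^ 2) +
        x.2 ⟨N - 1, by omega⟩ * ((x.1 ⟨N, by omega⟩ - x.1 ⟨N - 1, by omega⟩) +
          β * (x.1 ⟨N, by omega⟩ - x.1 ⟨N - 1, by omega⟩) ^ 3) := by
  have hU : Differentiable ℝ (pinnedChain ω₂ lam β γ).U :=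
    (pinnedChain_contDiff_U ω₂ lam β γ (n := 1)).differentiable one_ne_zero
  have hV : Differentiable ℝ (pinnedChain ω₂ lam β γ).V :=
    (pinnedChain_contDiff_V ω₂ lam β γ (n := 1)).differentiable one_ne_zero
  have hN1 : 1 ≤ N := by omega
  rw [generator_comp_restrictLeft (pinnedChain ω₂ lam β γ) hU hV hN1 hM T T T, generator_eq_weighted,
    gen_plain_hamiltonian γ hN1 T, kin_eq_sq (show 0 < N by omega),
    kin_eq_sq (show N - 1 < N by omega), pinnedChain_deriv_V]
  have hd1 : ∀ i : Fin N, partialP i ((pinnedChain ω₂ lam β γ).hamiltonian N) = fun y => y.2 i :=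
    fun i => funext fun y => (pinnedChain ω₂ lam β γ).partialP_hamiltonian N y i
  have hsum : (∑ i : Fin N, if i.val = N - 1 then
      T * partialP i (partialP i ((pinnedChain ω₂ lam β γ).hamiltonian N))
          (x.1 ∘ Fin.castAdd M, x.2 ∘ Fin.castAdd M) -
        x.2 (Fin.castAdd M i) * partialP i ((pinnedChain ω₂ lam β γ).hamiltonian N)
          (x.1 ∘ Fin.castAdd M, x.2 ∘ Fin.castAdd M) else 0) =
      T - x.2 ⟨N - 1, by omega⟩ ^ 2 := by
    rw [Finset.sum_eq_single ⟨N - 1, by omega⟩]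
    · simp only [if_true, hd1, partialP_snd, Function.comp_apply, Fin.castAdd_mk]
      ring
    · intro i _ hi
      have : i.val ≠ N - 1 := fun h => hi (Fin.ext h)
      simp [this]
    · intro h; exact absurd (Finset.mem_univ _) h
  rw [hsum, hd1]
  have hPγ : (pinnedChain ω₂ lam β γ).γ = γ := rfl
  simp only [Function.comp_apply, Fin.castAdd_mk, hPγ]
  ring


/-! ### `ĵ ∈ L²(μ_T)` -/

/-- The junction flux `ĵ = p_{N−1} V'(q_N − q_{N−1})` is in `L²(μ_T)`. -/
theorem floor_memLp_jhat (hω : 0 < ω₂) (hl : 0 ≤ lam) (hb : 0 ≤ β) (γ : ℝ) (hN : 1 ≤ N)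
    (hM : 1 ≤ M) {T : ℝ} (hT : 0 < T) :
    MemLp (fun x : PhaseSpace (N + M) => x.2 ⟨N - 1, by omega⟩ *
        ((x.1 ⟨N, by omega⟩ - x.1 ⟨N - 1, by omega⟩) +
          β * (x.1 ⟨N, by omega⟩ - x.1 ⟨N - 1, by omega⟩) ^ 3))
      2 ((pinnedChain ω₂ lam β γ).gibbsMeasure (N + M) T) := by
  have h := memLp_junctionForce_mul_comp_restrictLeft hω hl hb γ hN hM hT (M := M)
    (Φ := fun y : PhaseSpace N => y.2 ⟨N - 1, by omega⟩) (by fun_prop)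
    (pinnedChain_memLp_two_snd hω hl hb γ N hT ⟨N - 1, by omega⟩)
  refine (memLp_congr_ae (ae_of_all _ fun x => ?_)).mp h
  simp only [Function.comp_apply, Fin.castAdd_mk]
  ring

/-! ### The junction pairing `∫ ĵ h dμ_T` from the weak equation tested against `H_N ∘ π_N` -/

/-- **The junction pairing.** If `h ∈ L²(μ_T)` solves the plain `(N+M)`-chain's weak first-order
equation (`N, M ≥ 2`), then `∫ ĵ h dμ_T = γ ∫ (p_0² − T) h dμ_T − γ/2`: the weak equation tested
against the left-block energy `H_N ∘ π_N` (`L_T(H_N∘π_N) = γ(T − p_0²) + ĵ`,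
`∫ (H_N∘π_N) W dμ_T = γ/2`). With the Kubo link `G = γ(1/2 − ∫ (p_0² − T) h)` this reads
`∫ ĵ h dμ_T = −G`: to first order the mean energy flux into the left block through the junction
balances the power drawn from bath 1. -/
theorem floor_junction_pairing (hω : 0 < ω₂) (hl : 0 ≤ lam) (hb : 0 ≤ β) (γ : ℝ) (hN : 2 ≤ N)
    (hM : 2 ≤ M) {T : ℝ} (hT : 0 < T) {h : PhaseSpace (N + M) → ℝ}
    (hh : MemLp h 2 ((pinnedChain ω₂ lam β γ).gibbsMeasure (N + M) T))
    (hweak : ∀ f : PhaseSpace (N + M) → ℝ, ContDiff ℝ ∞ f → HasCompactSupport f →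
      ∫ x, (pinnedChain ω₂ lam β γ).generator (N + M) T T f x * h x
          ∂((pinnedChain ω₂ lam β γ).gibbsMeasure (N + M) T) =
        -∫ x, f x * plainSource (pinnedChain ω₂ lam β γ) T (N + M) x
          ∂((pinnedChain ω₂ lam β γ).gibbsMeasure (N + M) T)) :
    ∫ x, x.2 ⟨N - 1, by omega⟩ *
        ((x.1 ⟨N, by omega⟩ - x.1 ⟨N - 1, by omega⟩) +
          β * (x.1 ⟨N, by omega⟩ - x.1 ⟨N - 1, by omega⟩) ^ 3) * h x
        ∂((pinnedChain ω₂ lam β γ).gibbsMeasure (N + M) T) =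
      γ * ∫ x, (kin (N + M) 0 x - T) * h x ∂((pinnedChain ω₂ lam β γ).gibbsMeasure (N + M) T) - γ / 2 := by
  have hN1 : 1 ≤ N := by omega
  have hM1 : 1 ≤ M := by omega
  have hPγ : (pinnedChain ω₂ lam β γ).γ = γ := rfl
  haveI := pinnedChain_isProbabilityMeasure_gibbsMeasure hω hl hb γ (N + M) hT
  have hH0 := pinnedChain_hamiltonian_nonneg hω.le hl hb γ N
  -- (a) the test function `H_N ∘ π_N`: smooth, `L²`, momentum derivatives
  have hgs : ContDiff ℝ ((⊤ : ℕ∞) : WithTop ℕ∞) ((pinnedChain ω₂ lam β γ).hamiltonian N ∘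
          fun y : PhaseSpace (N + M) => (y.1 ∘ Fin.castAdd M, y.2 ∘ Fin.castAdd M)) :=
    (InsertionToolbox.pinnedChain_contDiff_hamiltonian ω₂ lam β γ N).comp contDiff_restrictLeft
  have hgd : Differentiable ℝ ((pinnedChain ω₂ lam β γ).hamiltonian N ∘
          fun y : PhaseSpace (N + M) => (y.1 ∘ Fin.castAdd M, y.2 ∘ Fin.castAdd M)) := hgs.differentiable (by simp)
  have hHL2 : MemLp ((pinnedChain ω₂ lam β γ).hamiltonian N) 2 ((pinnedChain ω₂ lam β γ).gibbsMeasure N T) :=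
    pinnedChain_memLp_two_of_abs_le hω hl hb γ N hT (pinnedChain_continuous_hamiltonian ω₂ lam β γ N)
      (C := 1) (k := 1) fun x => by rw [abs_of_nonneg (hH0 x), pow_one]; linarith [hH0 x]
  have hgL2 : MemLp ((pinnedChain ω₂ lam β γ).hamiltonian N ∘
          fun y : PhaseSpace (N + M) => (y.1 ∘ Fin.castAdd M, y.2 ∘ Fin.castAdd M)) 2 ((pinnedChain ω₂ lam β γ).gibbsMeasure (N + M) T) := memLp_comp_restrictLeft hω hl hb γ hN1 hM1 hT hHL2
  have hdl : ∀ i : Fin N, partialP (Fin.castAdd M i) ((pinnedChain ω₂ lam β γ).hamiltonian N ∘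
          fun y : PhaseSpace (N + M) => (y.1 ∘ Fin.castAdd M, y.2 ∘ Fin.castAdd M)) = fun x => x.2 (Fin.castAdd M i) := by
    intro i
    funext x
    rw [partialP_comp_restrictLeft_castAdd, OscillatorChain.partialP_hamiltonian]
    rfl
  have hdr : ∀ j : Fin M, partialP (Fin.natAdd N j) ((pinnedChain ω₂ lam β γ).hamiltonian N ∘
          fun y : PhaseSpace (N + M) => (y.1 ∘ Fin.castAdd M, y.2 ∘ Fin.castAdd M)) = fun _ => 0 := by
    intro j
    funext x
    exact partialP_comp_restrictLeft_natAdd _ j x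
  have hdg : ∀ i : Fin (N + M), MemLp (partialP i ((pinnedChain ω₂ lam β γ).hamiltonian N ∘
          fun y : PhaseSpace (N + M) => (y.1 ∘ Fin.castAdd M, y.2 ∘ Fin.castAdd M))) 2 ((pinnedChain ω₂ lam β γ).gibbsMeasure (N + M) T) := by
    intro i
    by_cases hi : i.val < N
    · have e : i = Fin.castAdd M ⟨i.val, hi⟩ := Fin.ext (by simp)
      rw [e, hdl]
      exact pinnedChain_memLp_two_snd hω hl hb γ (N + M) hT _
    · have e : i = Fin.natAdd N ⟨i.val - N, by omega⟩ := Fin.ext (by simp; omega)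
      rw [e, hdr]
      exact memLp_const 0
  -- (b) its generator `γ(T − p_0²) + ĵ`, in `L²` (then in the weighted form of the toolbox)
  have hJ := floor_memLp_jhat hω hl hb γ hN1 hM1 hT (M := M)
  have hK0 : MemLp (fun x : PhaseSpace (N + M) => x.2 ⟨0, by omega⟩ ^ 2 - T) 2 ((pinnedChain ω₂ lam β γ).gibbsMeasure (N + M) T) := by
    have e := memLp_kin_sub hω hl hb γ (N + M) hT 0 T
    simpa only [kin_eq_sq (show 0 < N + M by omega)] using e
  have hGen := floor_generator_leftEnergy ω₂ lam β γ T hN hM1 (M := M)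
  have hGgL2 : MemLp (fun x => (pinnedChain ω₂ lam β γ).generator (N + M) T T ((pinnedChain ω₂ lam β γ).hamiltonian N ∘
          fun y : PhaseSpace (N + M) => (y.1 ∘ Fin.castAdd M, y.2 ∘ Fin.castAdd M)) x) 2 ((pinnedChain ω₂ lam β γ).gibbsMeasure (N + M) T) := by
    have e : (fun x => (pinnedChain ω₂ lam β γ).generator (N + M) T T ((pinnedChain ω₂ lam β γ).hamiltonian N ∘
          fun y : PhaseSpace (N + M) => (y.1 ∘ Fin.castAdd M, y.2 ∘ Fin.castAdd M)) x) =
        fun x => (-γ) * (x.2 ⟨0, by omega⟩ ^ 2 - T) + x.2 ⟨N - 1, by omega⟩ *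
        ((x.1 ⟨N, by omega⟩ - x.1 ⟨N - 1, by omega⟩) +
          β * (x.1 ⟨N, by omega⟩ - x.1 ⟨N - 1, by omega⟩) ^ 3) := by
      funext x
      rw [hGen x]
      ring
    rw [e]
    exact (hK0.const_mul _).add hJ
  simp only [generator_eq_weighted] at hGgL2
  have hGenW := hGen
  simp only [generator_eq_weighted] at hGenW
  -- (c) the source in `L²` and the weak equation in weighted form
  have hW : MemLp (fun x => plainSource (pinnedChain ω₂ lam β γ) T (N + M) x) 2 ((pinnedChain ω₂ lam β γ).gibbsMeasure (N + M) T) := by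
    have e : (fun x => plainSource (pinnedChain ω₂ lam β γ) T (N + M) x) =
        fun x => (pinnedChain ω₂ lam β γ).γ / (2 * T ^ 2) *
          ((kin (N + M) 0 x - T) - (kin (N + M) (N + M - 1) x - T)) := by
      funext x
      simp only [plainSource]
      ring
    rw [e]
    exact ((memLp_kin_sub hω hl hb γ (N + M) hT 0 T).sub
      (memLp_kin_sub hω hl hb γ (N + M) hT (N + M - 1) T)).const_mul _
  have hweak' := hweak
  simp only [generator_eq_weighted] at hweak'
  have key := pinnedChain_weak_pairing hω hl hb γ (N + M) T
    (fun i : Fin (N + M) => (pinnedChain ω₂ lam β γ).γ *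
      ((if i.val = 0 then 1 else 0) + (if i.val = N + M - 1 then 1 else 0)))
    (m := ⊤) le_top hh hW hweak' hgs hgL2 hGgL2 (fun i _ => hdg i)
  -- (d) the right-hand side: `∫ (H_N∘π_N) W dμ_T = γ/2`
  have I0 : ∫ x, ((pinnedChain ω₂ lam β γ).hamiltonian N ∘
          fun y : PhaseSpace (N + M) => (y.1 ∘ Fin.castAdd M, y.2 ∘ Fin.castAdd M)) x * (x.2 ⟨0, by omega⟩ ^ 2 - T) ∂((pinnedChain ω₂ lam β γ).gibbsMeasure (N + M) T) = T ^ 2 := by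
    rw [integral_mul_sq_sub_gibbsMeasure hω hl hb γ (N + M) hT ⟨0, by omega⟩ hgd hgL2 (hdg ⟨0, by omega⟩)]
    have e0 : (⟨0, by omega⟩ : Fin (N + M)) = Fin.castAdd M ⟨0, by omega⟩ := Fin.ext (by simp)
    have hd0 : partialP (⟨0, by omega⟩ : Fin (N + M)) ((pinnedChain ω₂ lam β γ).hamiltonian N ∘
          fun y : PhaseSpace (N + M) => (y.1 ∘ Fin.castAdd M, y.2 ∘ Fin.castAdd M)) = fun x => x.2 ⟨0, by omega⟩ := by
      rw [e0, hdl]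
    rw [hd0]
    have e1 : ∫ x, (fun x : PhaseSpace (N + M) => x.2 ⟨0, by omega⟩) x * x.2 ⟨0, by omega⟩ ∂((pinnedChain ω₂ lam β γ).gibbsMeasure (N + M) T) =
        ∫ x, x.2 (⟨0, by omega⟩ : Fin (N + M)) ^ 2 ∂((pinnedChain ω₂ lam β γ).gibbsMeasure (N + M) T) :=
      integral_congr_ae (ae_of_all _ fun x => by simp only; ring)
    rw [e1, pinnedChain_integral_snd_sq hω hl hb γ (N + M) hT ⟨0, by omega⟩]
    ring
  have I1 : ∫ x, ((pinnedChain ω₂ lam β γ).hamiltonian N ∘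
          fun y : PhaseSpace (N + M) => (y.1 ∘ Fin.castAdd M, y.2 ∘ Fin.castAdd M)) x * (x.2 ⟨N + M - 1, by omega⟩ ^ 2 - T) ∂((pinnedChain ω₂ lam β γ).gibbsMeasure (N + M) T) = 0 := by
    have e := integral_comp_restrictLeft_mul_sq_sub hω hl hb γ hT ⟨M - 1, by omega⟩
      (f := (pinnedChain ω₂ lam β γ).hamiltonian N) hgL2
    have e1 : Fin.natAdd N (⟨M - 1, by omega⟩ : Fin M) = ⟨N + M - 1, by omega⟩ :=
      Fin.ext (by simp; omega)
    rw [e1] at e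
    exact e
  have i0 : Integrable (fun x => ((pinnedChain ω₂ lam β γ).hamiltonian N ∘
          fun y : PhaseSpace (N + M) => (y.1 ∘ Fin.castAdd M, y.2 ∘ Fin.castAdd M)) x * (x.2 ⟨0, by omega⟩ ^ 2 - T)) ((pinnedChain ω₂ lam β γ).gibbsMeasure (N + M) T) := hgL2.integrable_mul hK0
  have i1 : Integrable (fun x => ((pinnedChain ω₂ lam β γ).hamiltonian N ∘
          fun y : PhaseSpace (N + M) => (y.1 ∘ Fin.castAdd M, y.2 ∘ Fin.castAdd M)) x * (x.2 ⟨N + M - 1, by omega⟩ ^ 2 - T)) ((pinnedChain ω₂ lam β γ).gibbsMeasure (N + M) T) := by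
    have e := hgL2.integrable_mul (memLp_kin_sub hω hl hb γ (N + M) hT (N + M - 1) T)
    refine e.congr (ae_of_all _ fun x => ?_)
    simp only [Pi.mul_apply, kin_eq_sq (show N + M - 1 < N + M by omega)]
  have hRHS : ∫ x, ((pinnedChain ω₂ lam β γ).hamiltonian N ∘
          fun y : PhaseSpace (N + M) => (y.1 ∘ Fin.castAdd M, y.2 ∘ Fin.castAdd M)) x * plainSource (pinnedChain ω₂ lam β γ) T (N + M) x ∂((pinnedChain ω₂ lam β γ).gibbsMeasure (N + M) T) = γ / 2 := by
    have e : ∀ x, ((pinnedChain ω₂ lam β γ).hamiltonian N ∘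
          fun y : PhaseSpace (N + M) => (y.1 ∘ Fin.castAdd M, y.2 ∘ Fin.castAdd M)) x * plainSource (pinnedChain ω₂ lam β γ) T (N + M) x =
        γ / (2 * T ^ 2) * (((pinnedChain ω₂ lam β γ).hamiltonian N ∘
          fun y : PhaseSpace (N + M) => (y.1 ∘ Fin.castAdd M, y.2 ∘ Fin.castAdd M)) x * (x.2 ⟨0, by omega⟩ ^ 2 - T) -
          ((pinnedChain ω₂ lam β γ).hamiltonian N ∘
          fun y : PhaseSpace (N + M) => (y.1 ∘ Fin.castAdd M, y.2 ∘ Fin.castAdd M)) x * (x.2 ⟨N + M - 1, by omega⟩ ^ 2 - T)) := by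
      intro x
      simp only [plainSource, kin, hPγ]
      rw [kin_eq_sq (show 0 < N + M by omega), kin_eq_sq (show N + M - 1 < N + M by omega)]
      ring
    rw [integral_congr_ae (ae_of_all _ e), integral_const_mul, integral_sub i0 i1, I0, I1]
    have hT2 : T ^ 2 ≠ 0 := by positivity
    rw [sub_zero, div_mul_eq_mul_div, mul_comm (2 : ℝ) (T ^ 2), ← div_div, mul_div_assoc,
      div_self hT2, mul_one]
  -- (e) the left-hand side, and the conclusion
  have iK : Integrable (fun x : PhaseSpace (N + M) => (x.2 ⟨0, by omega⟩ ^ 2 - T) * h x) ((pinnedChain ω₂ lam β γ).gibbsMeasure (N + M) T) :=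
    hK0.integrable_mul hh
  have iJ : Integrable (fun x : PhaseSpace (N + M) => x.2 ⟨N - 1, by omega⟩ *
        ((x.1 ⟨N, by omega⟩ - x.1 ⟨N - 1, by omega⟩) +
          β * (x.1 ⟨N, by omega⟩ - x.1 ⟨N - 1, by omega⟩) ^ 3) * h x) ((pinnedChain ω₂ lam β γ).gibbsMeasure (N + M) T) := hJ.integrable_mul hh
  have key2 : ∫ x, ((-γ) * (x.2 ⟨0, by omega⟩ ^ 2 - T) + x.2 ⟨N - 1, by omega⟩ *
        ((x.1 ⟨N, by omega⟩ - x.1 ⟨N - 1, by omega⟩) +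
          β * (x.1 ⟨N, by omega⟩ - x.1 ⟨N - 1, by omega⟩) ^ 3)) * h x ∂((pinnedChain ω₂ lam β γ).gibbsMeasure (N + M) T) =
      -∫ x, ((pinnedChain ω₂ lam β γ).hamiltonian N ∘
          fun y : PhaseSpace (N + M) => (y.1 ∘ Fin.castAdd M, y.2 ∘ Fin.castAdd M)) x * plainSource (pinnedChain ω₂ lam β γ) T (N + M) x ∂((pinnedChain ω₂ lam β γ).gibbsMeasure (N + M) T) := by
    rw [← key]
    refine integral_congr_ae (ae_of_all _ fun x => ?_)
    beta_reduce
    rw [hGenW x]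
    ring
  have hsplit : ∫ x, ((-γ) * (x.2 ⟨0, by omega⟩ ^ 2 - T) + x.2 ⟨N - 1, by omega⟩ *
        ((x.1 ⟨N, by omega⟩ - x.1 ⟨N - 1, by omega⟩) +
          β * (x.1 ⟨N, by omega⟩ - x.1 ⟨N - 1, by omega⟩) ^ 3)) * h x ∂((pinnedChain ω₂ lam β γ).gibbsMeasure (N + M) T) =
      (-γ) * ∫ x, (x.2 ⟨0, by omega⟩ ^ 2 - T) * h x ∂((pinnedChain ω₂ lam β γ).gibbsMeasure (N + M) T) + ∫ x, x.2 ⟨N - 1, by omega⟩ *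
        ((x.1 ⟨N, by omega⟩ - x.1 ⟨N - 1, by omega⟩) +
          β * (x.1 ⟨N, by omega⟩ - x.1 ⟨N - 1, by omega⟩) ^ 3) * h x ∂((pinnedChain ω₂ lam β γ).gibbsMeasure (N + M) T) := by
    rw [← integral_const_mul, ← integral_add (iK.const_mul _) iJ]
    exact integral_congr_ae (ae_of_all _ fun x => by ring)
  rw [hsplit, hRHS] at key2
  simp only [kin, kin_eq_sq (show 0 < N + M by omega)]
  linarith


end Floor

/-- Registered helper sub-goal `helper_roughnessFloorPairing` (= `floor_junction_pairing` in stub form):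
for `h ∈ L²(μ_T)` solving the plain `(N+M)`-chain's weak first-order equation (`N, M ≥ 2`),
`∫ ĵ h dμ_T = γ ∫ (p_0² − T) h dμ_T − γ/2` with the junction flux `ĵ = p_{N−1} V'(q_N − q_{N−1})`
(with the Kubo link of the plain frame: `∫ ĵ h dμ_T = −G`). -/
theorem helper_roughnessFloorPairing : ∀ {ω₂ lam β : ℝ} {N M : ℕ}, 0 < ω₂ → 0 ≤ lam → 0 ≤ β → ∀ (γ : ℝ) (hN : 2 ≤ N) (hM : 2 ≤ M) {T : ℝ}, 0 < T → ∀ {h : PhaseSpace (N + M) → ℝ}, MemLp h 2 ((pinnedChain ω₂ lam β γ).gibbsMeasure (N + M) T) → (∀ f : PhaseSpace (N + M) → ℝ, ContDiff ℝ ∞ f → HasCompactSupport f → ∫ x, (pinnedChain ω₂ lam β γ).generator (N + M) T T f x * h x ∂((pinnedChain ω₂ lam β γ).gibbsMeasure (N + M) T) = -∫ x, f x * plainSource (pinnedChain ω₂ lam β γ) T (N + M) x ∂((pinnedChain ω₂ lam β γ).gibbsMeasure (N + M) T)) → ∫ x, x.2 ⟨N - 1, by omega⟩ * ((x.1 ⟨N,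 by omega⟩ - x.1 ⟨N - 1, by omega⟩) + β * (x.1 ⟨N, by omega⟩ - x.1 ⟨N - 1, by omega⟩) ^ 3) * h x ∂((pinnedChain ω₂ lam β γ).gibbsMeasure (N + M) T) = γ * ∫ x, (kin (N + M) 0 x - T) * h x ∂((pinnedChain ω₂ lam β γ).gibbsMeasure (N + M) T) - γ / 2 := by
  intro ω₂ lam β N M hω hl hb γ hN hM T hT h hh hweak
  exact floor_junction_pairing hω hl hb γ hN hM hT hh hweak

end Summit.AtomisticToContinuum.FouriersLaw.Cruxes.SuperadditiveResistance.ThermaliseThenCutProbeInsertion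

end
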